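import Summits.CriticalPhenomena.CardyFormulaZ2.Theorems.CardyBoundaryCoulombGasBoundaryDefectGaussianRStubTransportPathsPart25
import Summits.CriticalPhenomena.CardyFormulaZ2.Theorems.CardyBoundaryCoulombGasBoundaryDefectGaussianRStubTransportPathsPart27
import Summits.CriticalPhenomena.CardyFormulaZ2.Theorems.CardyBoundaryCoulombGasBoundaryDefectGaussianRStubTransportPathsPart28

/-!
# Stub `stub_transportPaths` of line `rainbow-monomials-in-excursion-kernels` — Part 29:
# the route of a counterclockwise mover: rail facts, separation, jumps, order
# (crux `CardyBoundaryCoulombGas.BoundaryDefectGaussianR`, stmt-CriticalPhenomena-14132)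

`tp_ccw_facts`: the three hypotheses of `tp_mover_fwd` (Part 22) for the point `m` with
`mark m < α` travelling from its initial rail point (edge `zm m`, coordinate `xi m`) to its slot
(edge `zA`, coordinate `an1 + x m`), the parked points being the slots of the points `i' > m` and
the initial points of the points `i' < m` (separation: Parts 25, 28; jumps: Part 27). [folklore]
-/

noncomputable section

open Set Filter Metric Topology Literature.Probability.RandomPlanarGeometry
open Literature.Probability.LatticeModels Literature.Probability.LatticeModels.CollarLegModel
open Summit.CriticalPhenomena.CardyFormulaZ2.Cruxes.RectilinearCardy.ExcursionKernelCovariance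

namespace Summit.CriticalPhenomena.CardyFormulaZ2.Cruxes.BoundaryDefectGaussianR.RainbowMonomialsInExcursionKernels

/-- Consecutive slots are `≥ r/δ` apart. [folklore] -/
theorem tp_slot_gap {r δ : ℝ} (hδ : 0 < δ) (hr : 0 ≤ r) {x₁ x₂ : ℤ} (hlt : x₁ < x₂)
    (h : (r / δ) ^ 2 ≤ (((x₂ - x₁) ^ 2 : ℤ) : ℝ)) : r / δ ≤ ((x₂ - x₁ : ℤ) : ℝ) := by
  have h2 : (0 : ℝ) ≤ ((x₂ - x₁ : ℤ) : ℝ) := by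
    have : (x₁ : ℝ) < x₂ := by exact_mod_cast hlt
    push_cast; linarith
  exact (pow_le_pow_iff_left₀ (div_nonneg hr hδ.le) h2 two_ne_zero).1 (by push_cast at h ⊢; linarith)

/-- **Registered sub-goal `s7_slotGap` of stub `stub_transportPaths`** (consecutive slots are
`≥ r/δ` apart, one-line form of `tp_slot_gap`; `tp_ccw_facts` exceeds the cap). [folklore] -/
theorem s7_slotGap : ∀ (r δ : ℝ), (0 < δ) → (0 ≤ r) → ∀ (x₁ x₂ : ℤ), (x₁ < x₂) → ((r / δ) ^ 2 ≤ (((x₂ - x₁) ^ 2 : ℤ) : ℝ)) → r / δ ≤ ((x₂ - x₁ : ℤ) : ℝ) :=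
  fun _ _ hδ hr _ _ hlt h => tp_slot_gap hδ hr hlt h

set_option maxHeartbeats 4000000 in
/-- **Route facts of a counterclockwise mover.** See the module docstring. [folklore] -/
theorem tp_ccw_facts {k : ℕ} (D : MarkedDomain k) {M : ℕ} {c : ℤ → ℝ} {a τ : ℤ → ℕ}
    (hcmono : StrictMono c) (hcper : ∀ z, c (z + M) = c z + 1)
    (ha4 : ∀ z, a z < 4) (hτ : ∀ z, τ z = 1 ∨ τ z = 3)
    (hmodτ : ∀ z, (a z + τ z) % 4 = (a (z - 1) + 2) % 4)
    (hdir : ∀ z, ∀ t ∈ Icc (c z) (c (z + 1)), D.boundary t =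
      D.boundary (c z) + ((‖D.boundary t - D.boundary (c z)‖ : ℝ) : ℂ) * Complex.I ^ (a z))
    (hmono : ∀ z, StrictMonoOn (fun t => ‖D.boundary t - D.boundary (c z)‖) (Icc (c z) (c (z + 1))))
    (hash : ∀ (z n : ℤ), a (z + n * M) = a z)
    {κ₀ : ℝ} (hκ₀ : ∀ z z' : ℤ, z + 2 ≤ z' → z' ≤ z + M - 2 →
      ∀ t ∈ Icc (c z) (c (z + 1)), ∀ t' ∈ Icc (c z') (c (z' + 1)),
        κ₀ ≤ dist (D.boundary t) (D.boundary t'))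
    {δ ρ r s₀ : ℝ} (hδ : 0 < δ) (hρδ : 64 * δ ≤ ρ) (hρr : ρ ≤ r) (hs₀ : 0 < s₀)
    {V : Finset (ℤ × ℤ)} (K : ℤ → Fin 4) (hK : ∀ z, K z = Fin.ofNat 4 (a z)) (Y : ℤ → ℤ)
    (hY : ∀ z, Y z = ⌈(D.boundary (c z) * (-Complex.I) ^ (a z)).im / δ⌉) (xon xoff : ℤ → ℤ)
    (Fl : ℤ × ℤ → Prop) (Sep JumpOK : ℤ × ℤ → ℤ × ℤ → Prop)
    (hSep : ∀ u v, Sep u v ↔ (r / δ) ^ 2 ≤ ((((u.1 - v.1) ^ 2 + (u.2 - v.2) ^ 2 : ℤ)) : ℝ))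
    (hA : ∀ (z x : ℤ), δ * ((⌈ρ / 4 / δ⌉₊ : ℕ) + 1) ≤ δ * x - (D.boundary (c z) * (-Complex.I) ^
      (a z)).re → δ * x - (D.boundary (c z) * (-Complex.I) ^ (a z)).re ≤ ‖D.boundary (c (z + 1)) -
      D.boundary (c z)‖ - δ * ((⌈ρ / 4 / δ⌉₊ : ℕ) + 1) → Fl ((x) • dir (K (z)) + Y (z) • dir (K
      (z) + 1)) ∧ ((x) • dir (K (z)) + Y (z) • dir (K (z) + 1)) ∈ V ∧ ((x) • dir (K (z)) + Y (z) •
      dir (K (z) + 1)) + dir (K (z) + 3) ∉ V ∧ ((neighbours ((x) • dir (K (z)) + Y (z) • dir (K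
      (z) + 1))).filter (fun w ↦ w ∉ V)).card = 1 ∧ outDart V ((x) • dir (K (z)) + Y (z) • dir (K
      (z) + 1)) = some (((x) • dir (K (z)) + Y (z) • dir (K (z) + 1)), K (z) + 3))
    (hB : ∀ z : ℤ, JumpOK ((xoff z) • dir (K ((z - 1))) + Y ((z - 1)) • dir (K ((z - 1)) + 1))
      ((xon z) • dir (K (z)) + Y (z) • dir (K (z) + 1)) ∧ (∃ g : ℕ, (dsucc V)^[g] (((xoff z) • dir
      (K ((z - 1))) + Y ((z - 1)) • dir (K ((z - 1)) + 1)), K (z - 1) + 3) = (((xon z) • dir (K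
      (z)) + Y (z) • dir (K (z) + 1)), K z + 3)) ∧ (δ * ((((⌈ρ / 4 / δ⌉₊ + 3 : ℕ) : ℝ)) - 1) ≤ δ *
      (xon z : ℤ) - (D.boundary (c z) * (-Complex.I) ^ (a z)).re ∧ δ * (xon z : ℤ) - (D.boundary
      (c z) * (-Complex.I) ^ (a z)).re ≤ δ * ((((⌈ρ / 4 / δ⌉₊ + 3 : ℕ) : ℝ)) + 1)) ∧ (‖D.boundary
      (c ((z - 1) + 1)) - D.boundary (c (z - 1))‖ - δ * ((((⌈ρ / 4 / δ⌉₊ + 3 : ℕ) : ℝ)) + 1) ≤ δ *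
      (xoff z : ℤ) - (D.boundary (c (z - 1)) * (-Complex.I) ^ (a (z - 1))).re ∧ δ * (xoff z : ℤ) -
      (D.boundary (c (z - 1)) * (-Complex.I) ^ (a (z - 1))).re ≤ ‖D.boundary (c ((z - 1) + 1)) -
      D.boundary (c (z - 1))‖ - δ * ((((⌈ρ / 4 / δ⌉₊ + 3 : ℕ) : ℝ)) - 1)))
    (zm : Fin k → ℤ) (hzm : ∀ i, D.mark i ∈ Ioo (c (zm i)) (c (zm i + 1))) {α : ℝ} {zA : ℤ}
    (hzA0 : a zA = 0) (hαA : α ∈ Ioo (c zA) (c (zA + 1))) (hα1 : α < 1)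
    {η₀ κ₁ dmm dA dmc dAc Λ ℓmin : ℝ} (hη₀ : 0 < η₀)
    (hκ₁ : ∀ s t : ℝ, (∀ n : ℤ, η₀ ≤ |s - t - n|) → κ₁ ≤ dist (D.boundary s) (D.boundary t))
    (hgap1 : ∀ i i', i ≠ i' → ∀ n : ℤ, 2 * η₀ ≤ |D.mark i - D.mark i' - n|)
    (hgap2 : ∀ i, ∀ n : ℤ, 2 * η₀ ≤ |α - D.mark i - n|)
    (hdmm : ∀ i i', i ≠ i' → dmm ≤ dist (D.pt i) (D.pt i'))
    (hdA : ∀ i, dA ≤ dist (D.boundary α) (D.pt i))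
    (hdmc : ∀ i, dmc ≤ ‖D.pt i - D.boundary (c (zm i))‖ ∧ dmc ≤ ‖D.boundary (c (zm i + 1)) - D.pt i‖)
    (hdAc : dAc ≤ ‖D.boundary α - D.boundary (c zA)‖ ∧ dAc ≤ ‖D.boundary (c (zA + 1)) - D.boundary α‖)
    (hΛ : ∀ z, ‖D.boundary (c (z + 1)) - D.boundary (c z)‖ ≤ Λ)
    (hℓmin : ∀ z, ℓmin ≤ ‖D.boundary (c (z + 1)) - D.boundary (c z)‖)
    (hrκ₀ : 16 * r ≤ κ₀) (hrκ₁ : 16 * r ≤ κ₁) (hrdmm : 16 * r ≤ dmm) (hrdA : 16 * r ≤ dA)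
    (hrdmc : 16 * r ≤ dmc) (hrdAc : 16 * r ≤ dAc) (hrℓ : 16 * r ≤ ℓmin) (hs₀A : 4 * s₀ ≤ dA)
    (hs₀Ac : 4 * s₀ ≤ dAc)
    (p : Fin k → ℤ × ℤ) (xi : Fin k → ℤ)
    (hp_eq : ∀ i, p i = (xi i) • dir (K (zm i)) + Y (zm i) • dir (K (zm i) + 1))
    (hp_coord : ∀ i, |δ * (xi i : ℤ) - ((D.boundary (c (zm i)) * (-Complex.I) ^ (a (zm i))).re +
      ‖D.pt i - D.boundary (c (zm i))‖)| ≤ r / 4)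
    (x : Fin k → ℤ) (hxmono : StrictMono x)
    (hxsep : ∀ i₁ i₂ : Fin k, i₁ ≠ i₂ → (r / δ) ^ 2 ≤ (((x i₁ - x i₂) ^ 2 : ℤ) : ℝ))
    (hxs₀ : ∀ i, |δ * (x i : ℤ)| ≤ s₀) (an1 : ℤ)
    (han1 : (D.boundary α).re - δ < δ * an1 ∧ δ * an1 ≤ (D.boundary α).re)
    (m : Fin k) (hm : D.mark m < α) (P : Fin k → ℤ × ℤ)
    (hP : ∀ i', i' ≠ m → P i' = if m < i' then (an1 + x i') • dir (K zA) + Y zA • dir (K zA + 1) else p i') :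
    (∀ (z xx : ℤ), zm m ≤ z → z ≤ zA → (z = zm m → xi m ≤ xx) → (z ≠ zm m → xon z ≤ xx) → (z = zA
      → xx ≤ an1 + x m) → (z ≠ zA → xx ≤ xoff (z + 1)) → (Fl ((xx) • dir (K (z)) + Y (z) • dir (K
      (z) + 1)) ∧ (∀ i', i' ≠ m → Sep ((xx) • dir (K (z)) + Y (z) • dir (K (z) + 1)) (P i') ∧ Sep
      (P i') ((xx) • dir (K (z)) + Y (z) • dir (K (z) + 1))) ∧ ((xx) • dir (K (z)) + Y (z) • dir
      (K (z) + 1)) ∈ V ∧ ((xx) • dir (K (z)) + Y (z) • dir (K (z) + 1)) + dir (K (z) + 3) ∉ V ∧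
      ((neighbours ((xx) • dir (K (z)) + Y (z) • dir (K (z) + 1))).filter (fun w ↦ w ∉ V)).card =
      1 ∧ outDart V ((xx) • dir (K (z)) + Y (z) • dir (K (z) + 1)) = some (((xx) • dir (K (z)) + Y
      (z) • dir (K (z) + 1)), K (z) + 3))) ∧
    (∀ z : ℤ, zm m < z → z ≤ zA → JumpOK ((xoff z) • dir (K ((z - 1))) + Y ((z - 1)) • dir (K ((z
      - 1)) + 1)) ((xon z) • dir (K (z)) + Y (z) • dir (K (z) + 1)) ∧ ∃ g : ℕ, (dsucc V)^[g]
      (((xoff z) • dir (K ((z - 1))) + Y ((z - 1)) • dir (K ((z - 1)) + 1)), K (z - 1) + 3) =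
      (((xon z) • dir (K (z)) + Y (z) • dir (K (z) + 1)), K z + 3)) ∧
    ((zm m = zA → xi m ≤ an1 + x m ∧ an1 + x m - xi m ≤ ((⌈Λ / δ⌉₊ + 2 : ℕ) : ℤ)) ∧ (zm m < zA →
      xi m ≤ xoff (zm m + 1) ∧ xoff (zm m + 1) - xi m ≤ ((⌈Λ / δ⌉₊ + 2 : ℕ) : ℤ)) ∧ (∀ z : ℤ, zm m
      < z → z < zA → xon z ≤ xoff (z + 1) ∧ xoff (z + 1) - xon z ≤ ((⌈Λ / δ⌉₊ + 2 : ℕ) : ℤ)) ∧ (zm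
      m < zA → xon zA ≤ an1 + x m ∧ an1 + x m - xon zA ≤ ((⌈Λ / δ⌉₊ + 2 : ℕ) : ℤ))) := by
  have hr : 0 < r := by linarith
  have hδr : 64 * δ ≤ r := hρδ.trans hρr
  have hpt : ∀ i, D.pt i = D.boundary (D.mark i) := fun i => rfl
  have hczlt : ∀ z : ℤ, c z < c (z + 1) := fun z => hcmono (by omega)
  have hmρ : δ * (((⌈ρ / 4 / δ⌉₊ : ℕ) : ℝ) + 1) < ρ / 4 + 2 * δ := tp_radius_margin hδ (by linarith)
  have hmρ' : δ * (((⌈ρ / 4 / δ⌉₊ : ℕ) : ℝ) + 1) ≤ r / 2 := by linarith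
  have hJ1 : δ * ((((⌈ρ / 4 / δ⌉₊ + 3 : ℕ) : ℝ)) + 1) ≤ r / 2 := by
    push_cast; rw [show δ * ((⌈ρ / 4 / δ⌉₊ : ℝ) + 3 + 1) = δ * ((⌈ρ / 4 / δ⌉₊ : ℝ) + 1) + 3 * δ by ring]
    linarith
  have hJ2 : δ * (((⌈ρ / 4 / δ⌉₊ : ℕ) : ℝ) + 1) ≤ δ * ((((⌈ρ / 4 / δ⌉₊ + 3 : ℕ) : ℝ)) - 1) := by
    push_cast; rw [show δ * ((⌈ρ / 4 / δ⌉₊ : ℝ) + 3 - 1) = δ * ((⌈ρ / 4 / δ⌉₊ : ℝ) + 1) + δ by ring]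
    linarith
  have hJ3 : 0 ≤ δ * ((((⌈ρ / 4 / δ⌉₊ + 3 : ℕ) : ℝ)) - 1) :=
    mul_nonneg hδ.le (by push_cast; linarith [(Nat.cast_nonneg _ : (0 : ℝ) ≤ (⌈ρ / 4 / δ⌉₊ : ℕ))])
  have hW1 : ∀ u v : ℤ, ∀ z : ℤ, 0 ≤ δ * u - (D.boundary (c z) * (-Complex.I) ^ (a z)).re →
      δ * v - (D.boundary (c z) * (-Complex.I) ^ (a z)).re ≤ ‖D.boundary (c (z + 1)) - D.boundary (c z)‖ →
      v - u ≤ ((⌈Λ / δ⌉₊ + 2 : ℕ) : ℤ) := by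
    intro u v z hu hv
    have h1 : δ * ((v : ℝ) - u) ≤ Λ := by have := hΛ z; rw [mul_sub]; linarith
    have h2 : (v : ℝ) - u ≤ Λ / δ := by rw [le_div_iff₀ hδ]; linarith
    have : ((v - u : ℤ) : ℝ) ≤ ((⌈Λ / δ⌉₊ + 2 : ℕ) : ℤ) := by
      push_cast; linarith [(Nat.le_ceil _ : Λ / δ ≤ (⌈Λ / δ⌉₊ : ℕ))]
    exact_mod_cast this
  have hdiv : ∀ u v : ℤ, δ * (u : ℝ) ≤ δ * (v : ℝ) → u ≤ v := fun u v h => by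
    exact_mod_cast (le_of_mul_le_mul_left h hδ : (u : ℝ) ≤ v)
  have hzs := hzm m
  set sm := ‖D.pt m - D.boundary (c (zm m))‖ with hsm
  obtain ⟨-, -, hsmℓ⟩ := tp_inside_dist D.toJordanDomain hcmono hdir hmono (zm m) hzs
  have hdm := hdmc m
  rw [← hpt] at hsmℓ
  change ‖D.boundary (c ((zm m) + 1)) - D.pt m‖ = ‖D.boundary (c ((zm m) + 1)) - D.boundary (c (zm m))‖ - sm
    at hsmℓ
  rw [hsmℓ] at hdm
  have hinit := fun i => abs_le.1 (hp_coord i)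
  set sα := ‖D.boundary α - D.boundary (c zA)‖ with hsα
  obtain ⟨-, -, hsαℓ⟩ := tp_inside_dist D.toJordanDomain hcmono hdir hmono zA hαA
  change ‖D.boundary (c (zA + 1)) - D.boundary α‖ = ‖D.boundary (c (zA + 1)) - D.boundary (c zA)‖ - sα
    at hsαℓ
  have hdAc' := hdAc
  rw [hsαℓ] at hdAc'
  have hA0 : (D.boundary (c zA) * (-Complex.I) ^ (a zA)).re = (D.boundary (c zA)).re := by
    rw [hzA0, pow_zero, mul_one]
  have hαre : (D.boundary α).re = (D.boundary (c zA)).re + sα := by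
    have h := hdir zA α ⟨hαA.1.le, hαA.2.le⟩
    rw [hzA0, pow_zero, mul_one] at h
    rw [h, Complex.add_re, Complex.ofReal_re]
  have hslot_s : ∀ i, sα - δ - s₀ ≤ δ * ((an1 + x i : ℤ) : ℝ) - (D.boundary (c zA) * (-Complex.I) ^ (a zA)).re ∧
      δ * ((an1 + x i : ℤ) : ℝ) - (D.boundary (c zA) * (-Complex.I) ^ (a zA)).re ≤ sα + s₀ := by
    intro i
    have hx := abs_le.1 (hxs₀ i)
    rw [hA0]; push_cast
    constructor <;> linarith [han1.1, han1.2, hαre]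
  have hzsA : (zm m) ≤ zA := by
    by_contra h
    have := hcmono.monotone (show zA + 1 ≤ (zm m) by omega); linarith [hαA.2, hzs.1, hm]
  have hzAs : zA ≤ (zm m) + M := by
    by_contra h
    have h1 := hcmono.monotone (show (zm m) + 1 + M ≤ zA by omega)
    have h2 := hcper ((zm m) + 1); linarith [hαA.1, hzs.2, (D.mark_mem m).1, hα1]
  have hxgap : ∀ i', m < i' → r / δ ≤ ((x i' - x m : ℤ) : ℝ) := fun i' hi' =>
    tp_slot_gap hδ hr.le (hxmono hi') (hxsep i' m hi'.ne')
  refine ⟨?_, fun z hz1 hz2 => ⟨(hB z).1, (hB z).2.1⟩, ?_⟩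
  ·
    intro z xx hz1 hz2 hlo1 hlo2 hhi1 hhi2
    have hlow : δ * (((⌈ρ / 4 / δ⌉₊ : ℕ) : ℝ) + 1) ≤ δ * xx - (D.boundary (c z) * (-Complex.I) ^ (a z)).re := by
      by_cases hzz : z = (zm m)
      · have h := hlo1 hzz
        rw [hzz]
        have h' : δ * (xi m : ℝ) ≤ δ * (xx : ℝ) :=
          mul_le_mul_of_nonneg_left (by exact_mod_cast h) hδ.le
        linarith [(hinit m).1, hdm.1]
      · have h := hlo2 hzz
        have h' : δ * (xon z : ℝ) ≤ δ * (xx : ℝ) :=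
          mul_le_mul_of_nonneg_left (by exact_mod_cast h) hδ.le
        linarith [(hB z).2.2.1.1]
    have hhigh : δ * xx - (D.boundary (c z) * (-Complex.I) ^ (a z)).re ≤
        ‖D.boundary (c (z + 1)) - D.boundary (c z)‖ - δ * (((⌈ρ / 4 / δ⌉₊ : ℕ) : ℝ) + 1) := by
      by_cases hzz : z = zA
      · have h := hhi1 hzz
        rw [hzz]
        have h' : δ * (xx : ℝ) ≤ δ * ((an1 + x m : ℤ) : ℝ) :=
          mul_le_mul_of_nonneg_left (by exact_mod_cast h) hδ.le
        linarith [(hslot_s m).2, hdAc'.2]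
      · have h := hhi2 hzz
        have hBz := hB (z + 1)
        simp only [add_sub_cancel_right] at hBz
        have h' : δ * (xx : ℝ) ≤ δ * (xoff (z + 1) : ℝ) :=
          mul_le_mul_of_nonneg_left (by exact_mod_cast h) hδ.le
        linarith [hBz.2.2.2.2]
    obtain ⟨hFl, hrailfacts⟩ := hA z xx hlow hhigh
    refine ⟨hFl, ?_, hrailfacts⟩
    intro i' hi'
    rw [hP i' hi']
    have hm0 : 0 ≤ δ * (((⌈ρ / 4 / δ⌉₊ : ℕ) : ℝ) + 1) := by positivity
    have hs0 : 0 ≤ δ * xx - (D.boundary (c z) * (-Complex.I) ^ (a z)).re := hm0.trans hlow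
    have hsℓ : δ * xx - (D.boundary (c z) * (-Complex.I) ^ (a z)).re ≤
        ‖D.boundary (c (z + 1)) - D.boundary (c z)‖ := by linarith
    split_ifs with hlt
    ·
      by_cases hzz : z = zA
      · -- same rail, slots ahead
        have h := hhi1 hzz
        rw [hzz]
        have key := tp_sep_same_rail hδ hr.le (K zA) (Y zA) xx (an1 + x i') (by
          have hg := hxgap i' hlt
          have h1 : (xx : ℝ) ≤ ((an1 + x m : ℤ) : ℝ) := by exact_mod_cast h
          have h0 : (0 : ℝ) ≤ r / δ := by positivity
          push_cast at h1 hg ⊢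
          rw [abs_sub_comm, abs_of_nonneg (by linarith)]
          linarith)
        rw [hSep, hSep]
        exact ⟨key, tp_sep_symm _ _ key⟩
      · have hzlt : z < zA := lt_of_le_of_ne hz2 hzz
        by_cases hzw : z = zA - M
        · -- the wrap case: the start edge is the anchor edge, the slots are behind
          have hzzs : z = (zm m) := le_antisymm (by omega) hz1
          have hzw' : z = zA + (-1) * M := by rw [hzw]; ring
          have haz : a z = a zA := by rw [hzw', hash]
          have hcz' : D.boundary (c z) = D.boundary (c zA) := by
            rw [hzw']; exact tp_point_shift D.toJordanDomain hcper zA (-1)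
          have hKz : K z = K zA := by rw [hK, hK, haz]
          have hYz : Y z = Y zA := by rw [hY, hY, haz, hcz']
          have hAz : (D.boundary (c z) * (-Complex.I) ^ (a z)).re =
              (D.boundary (c zA) * (-Complex.I) ^ (a zA)).re := by rw [haz, hcz']
          have hmk1 : D.mark m + 1 ∈ Ioo (c zA) (c (zA + 1)) := by
            have h1 := hzs.1
            have h2 := hzs.2
            rw [← hzzs, hzw] at h1 h2
            have e1 := tp_c_shift hcper zA (-1)
            have e2 := tp_c_shift hcper (zA + 1) (-1)
            rw [show zA + -1 * (M : ℤ) = zA - M by ring] at e1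
            rw [show zA + 1 + -1 * (M : ℤ) = zA - M + 1 by ring] at e2
            rw [e1] at h1; rw [e2] at h2
            push_cast at h1 h2; exact ⟨by linarith, by linarith⟩
          have hper : D.boundary (D.mark m + 1) = D.pt m := by
            rw [hpt]; exact D.periodic_boundary _
          have hsm' : ‖D.pt m - D.boundary (c zA)‖ = sm := by rw [hsm, ← hzzs, hcz']
          have hdist := tp_same_edge_dist D.toJordanDomain hdir zA ⟨hmk1.1.le, hmk1.2.le⟩
            ⟨hαA.1.le, hαA.2.le⟩
          have hlt2 : sα < ‖D.boundary (D.mark m + 1) - D.boundary (c zA)‖ :=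
            hmono zA ⟨hαA.1.le, hαA.2.le⟩ ⟨hmk1.1.le, hmk1.2.le⟩ (by linarith [(D.mark_mem m).1])
          change dist (D.boundary (D.mark m + 1)) (D.boundary α) =
            |‖D.boundary (D.mark m + 1) - D.boundary (c zA)‖ - sα| at hdist
          rw [abs_of_pos (by linarith), hper, hsm'] at hdist
          rw [hper] at hlt2
          have hdA' := hdA m
          rw [dist_comm, hdist] at hdA'
          have hxx : δ * (xi m : ℝ) ≤ δ * (xx : ℝ) :=
            mul_le_mul_of_nonneg_left (by exact_mod_cast hlo1 hzzs) hδ.le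
          have hi1 := (hinit m).1
          rw [← hzzs] at hi1
          rw [hAz, hcz', hsm'] at hi1
          rw [hKz, hYz]
          have key := tp_sep_same_rail hδ hr.le (K zA) (Y zA) xx (an1 + x i') (by
            have hs2 := (hslot_s i').2
            push_cast at hs2 hi1 hxx ⊢
            have hge : r ≤ δ * ((xx : ℝ) - (an1 + x i')) := by
              rw [mul_sub]; linarith [hdA', hxx, hs₀A, hrdA]
            rw [abs_of_nonneg (by nlinarith), div_le_iff₀ hδ]
            linarith)
          rw [hSep, hSep]
          exact ⟨key, tp_sep_symm _ _ key⟩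
        · -- another edge: far from the anchor edge
          have hzgt : zA - M < z := lt_of_le_of_ne (by omega) (Ne.symm hzw)
          rw [hSep, hSep, hK z, hK zA, hY z, hY zA]
          refine tp_sep_rail_points D.toJordanDomain hcmono ha4 hdir hδ hr.le z xx zA (an1 + x i') hs0 hsℓ
            (by linarith [(hslot_s i').1, hdAc.1]) (by linarith [(hslot_s i').2, hdAc'.2]) ?_
          intro t ht tw htw hnt hntw
          have hper : D.boundary t = D.boundary (t + 1) := (D.periodic_boundary t).symm
          have ht1 : t + 1 ∈ Icc (c (z + M)) (c (z + M + 1)) := by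
            rw [hcper z, show z + (M : ℤ) + 1 = (z + 1) + M by ring, hcper (z + 1)]
            exact ⟨by linarith [ht.1], by linarith [ht.2]⟩
          have key := tp_slot_dist D.toJordanDomain hcmono hcper ha4 hτ hmodτ hdir hmono hash hκ₀ zA (z + M)
            (by omega) (by omega) htw ht1
          rw [← hper, hntw] at key
          have hfar : ‖D.boundary (c (zA + 1)) - D.boundary tw‖ =
              ‖D.boundary (c (zA + 1)) - D.boundary (c zA)‖ -
                (δ * ((an1 + x i' : ℤ) : ℝ) - (D.boundary (c zA) * (-Complex.I) ^ (a zA)).re) := by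
            have h := tp_same_edge_dist D.toJordanDomain hdir zA ⟨(hczlt zA).le, le_rfl⟩ htw
            rw [dist_eq_norm] at h
            rw [h, hntw, abs_of_nonneg (by linarith [(hslot_s i').2, hdAc'.2])]
          rw [hfar] at key
          have hmin : r + 2 * δ ≤ min κ₀ (min (δ * ((an1 + x i' : ℤ) : ℝ) -
              (D.boundary (c zA) * (-Complex.I) ^ (a zA)).re)
              (‖D.boundary (c (zA + 1)) - D.boundary (c zA)‖ -
                (δ * ((an1 + x i' : ℤ) : ℝ) - (D.boundary (c zA) * (-Complex.I) ^ (a zA)).re))) := by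
            refine le_min (by linarith) (le_min ?_ ?_)
            · linarith [(hslot_s i').1, hdAc.1]
            · linarith [(hslot_s i').2, hdAc'.2]
          exact hmin.trans key
    ·
      have hlt' : i' < m := lt_of_le_of_ne (not_lt.1 hlt) hi'
      rw [hp_eq i', hSep, hSep, hK z, hK (zm i'), hY z, hY (zm i')]
      have hzi := hzm i'
      set si := ‖D.pt i' - D.boundary (c (zm i'))‖ with hsi
      obtain ⟨-, -, hsiℓ⟩ := tp_inside_dist D.toJordanDomain hcmono hdir hmono (zm i') hzi
      have hdi := hdmc i'
      rw [← hpt] at hsiℓ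
      change ‖D.boundary (c (zm i' + 1)) - D.pt i'‖ =
        ‖D.boundary (c (zm i' + 1)) - D.boundary (c (zm i'))‖ - si at hsiℓ
      rw [hsiℓ] at hdi
      refine tp_sep_rail_points D.toJordanDomain hcmono ha4 hdir hδ hr.le z xx (zm i') (xi i') hs0 hsℓ
        (by linarith [(hinit i').1, hdi.1]) (by linarith [(hinit i').2, hdi.2]) ?_
      intro t ht t' ht' hnt hnt'
      have h1 : dist (D.boundary (D.mark i')) (D.boundary t') ≤ r / 4 := by
        rw [tp_same_edge_dist D.toJordanDomain hdir (zm i') ⟨hzi.1.le, hzi.2.le⟩ ht', hnt', ← hpt]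
        rw [abs_le]; constructor <;> linarith [(hinit i').1, (hinit i').2]
      have hout : ∀ n : ℤ, D.mark i' + n ∉ Ioo (D.mark m) α := by
        intro n hn
        have hlt'' := D.strictMono_mark hlt'
        rcases le_or_gt n 0 with hn0 | hn0
        · have : (n : ℝ) ≤ 0 := by exact_mod_cast hn0
          linarith [hn.1]
        · linarith [hn.2, (D.mark_mem i').1, (by exact_mod_cast hn0 : (1 : ℝ) ≤ n)]
      have hregime : t ∈ Icc (D.mark m) α ∨ dist (D.boundary t) (D.boundary (D.mark m)) ≤ r / 4 ∨
          dist (D.boundary t) (D.boundary α) ≤ s₀ := by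
        by_cases ht1 : t < D.mark m
        · right; left
          have hzz : z = (zm m) := by
            by_contra hne'
            have := hcmono.monotone (show (zm m) + 1 ≤ z by omega); linarith [ht.1, hzs.2]
          subst hzz
          have hxx := hlo1 rfl
          rw [tp_same_edge_dist D.toJordanDomain hdir (zm m) ht ⟨hzs.1.le, hzs.2.le⟩, hnt, ← hpt]
          have hlt3 : δ * ↑xx - (D.boundary (c (zm m)) * (-Complex.I) ^ a (zm m)).re < sm :=
            by rw [← hnt]; exact hmono (zm m) ht ⟨hzs.1.le, hzs.2.le⟩ ht1
          have h4 : δ * (xi m : ℝ) ≤ δ * (xx : ℝ) :=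
            mul_le_mul_of_nonneg_left (by exact_mod_cast hxx) hδ.le
          rw [abs_le]; constructor <;> linarith [(hinit m).1]
        · by_cases ht2 : α < t
          · right; right
            have hzz : z = zA := by
              by_contra hne'
              have := hcmono.monotone (show z + 1 ≤ zA by omega); linarith [ht.2, hαA.1]
            have hxx := hhi1 hzz
            rw [hzz] at ht hnt
            rw [tp_same_edge_dist D.toJordanDomain hdir zA ht ⟨hαA.1.le, hαA.2.le⟩, hnt]
            change |δ * ↑xx - (D.boundary (c zA) * (-Complex.I) ^ a zA).re - sα| ≤ s₀
            have hlt3 : sα < δ * ↑xx - (D.boundary (c zA) * (-Complex.I) ^ a zA).re := by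
              rw [← hnt]; exact hmono zA ⟨hαA.1.le, hαA.2.le⟩ ht ht2
            have h4 : δ * (xx : ℝ) ≤ δ * ((an1 + x m : ℤ) : ℝ) :=
              mul_le_mul_of_nonneg_left (by exact_mod_cast hxx) hδ.le
            rw [abs_le]; constructor <;> linarith [(hslot_s m).2]
          · left; exact ⟨not_lt.1 ht1, not_lt.1 ht2⟩
      have h2 := tp_sep_regimes D.boundary hη₀ hκ₁ (hgap1 m i' hlt'.ne') (hgap2 i') hout
        (θ₁ := r / 4) (θ₂ := s₀) (hdmm m i' hlt'.ne') (hdA i') (q := D.boundary t) rfl hregime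
      rw [← hpt] at h2 h1
      rw [dist_comm] at h1
      have h3 := dist_triangle (D.boundary t) (D.boundary t') (D.pt i')
      have hmin : r + 2 * δ + r / 4 ≤ min κ₁ (min (dmm - r / 4) (dA - s₀)) :=
        le_min (by linarith) (le_min (by linarith) (by linarith))
      linarith
  ·
    refine ⟨fun hzz => ?_, fun hlt => ?_, fun z hz1 hz2 => ?_, fun hlt => ?_⟩
    · -- single edge: the slot is ahead of the initial point by ≥ dA
      have hsm' : ‖D.pt m - D.boundary (c zA)‖ = sm := by rw [hsm, hzz]
      have hdist := tp_same_edge_dist D.toJordanDomain hdir zA ⟨hαA.1.le, hαA.2.le⟩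
        (t₂ := D.mark m) (by rw [← hzz]; exact ⟨hzs.1.le, hzs.2.le⟩)
      have hlt2 : sm < sα := by
        rw [← hsm', hpt]
        exact hmono zA (by rw [← hzz]; exact ⟨hzs.1.le, hzs.2.le⟩) ⟨hαA.1.le, hαA.2.le⟩ hm
      rw [← hpt, hsm', abs_of_pos (by linarith)] at hdist
      have hdA' := hdA m
      rw [hdist] at hdA'
      have hi := hinit m
      rw [hzz] at hi
      rw [hsm'] at hi
      constructor
      · apply hdiv; linarith [hi.2, (hslot_s m).1]
      · refine hW1 _ _ zA (by linarith [hi.1, hdm.1]) (by linarith [(hslot_s m).2, hdAc'.2])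
    · have hBz := hB ((zm m) + 1)
      simp only [add_sub_cancel_right] at hBz
      constructor
      · apply hdiv; linarith [(hinit m).2, hdm.2, hBz.2.2.2.1]
      · exact hW1 _ _ (zm m) (by linarith [(hinit m).1, hdm.1]) (by linarith [hBz.2.2.2.2])
    · have hBz := hB (z + 1)
      simp only [add_sub_cancel_right] at hBz
      constructor
      · apply hdiv; linarith [(hB z).2.2.1.2, hBz.2.2.2.1, hℓmin z]
      · exact hW1 _ _ z (by linarith [(hB z).2.2.1.1]) (by linarith [hBz.2.2.2.2])
    · constructor
      · apply hdiv; linarith [(hB zA).2.2.1.2, (hslot_s m).1, hdAc.1]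
      · exact hW1 _ _ zA (by linarith [(hB zA).2.2.1.1]) (by linarith [(hslot_s m).2, hdAc'.2])
end Summit.CriticalPhenomena.CardyFormulaZ2.Cruxes.BoundaryDefectGaussianR.RainbowMonomialsInExcursionKernels

end
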